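import Mathlib
import HarnessLib
import Summits.HubbardSuperconductivity.HubbardSuperconductivity.Theorems.KLProgrammePerturbedFermiCurveTower
import Summits.HubbardSuperconductivity.HubbardSuperconductivity.Theorems.KLProgrammePerturbedFermiCurveNumerics
import Summits.HubbardSuperconductivity.HubbardSuperconductivity.Theorems.KLProgrammePerturbedFermiCurveHigherDerivsFrame
import Summits.HubbardSuperconductivity.HubbardSuperconductivity.Theorems.KLProgrammeKLRegimeSplitPredicatesV5
import Summits.HubbardSuperconductivity.HubbardSuperconductivity.Theorems.KLProgrammeKLRegimeSplitTwoLegSizesMSOfCurveJet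

/-!
# K3 under scheme F — the (E3a-F) ANGULAR-JET LINK, STRUCTURED: symbol sizes of BGM shape `μ_l·U²·4^{(l−2)n}` AT THE CURVE POINTS of a frame of
# depth `N ≤ n` give the reading jets `|∂_θ^k (F ∘ γ_K)| ≤ curveJetBar (readJetC μ) (readJetC' R μ) U k n`, `1 ≤ k ≤ 4`, with n-FREE tables

Cell gate-hubbard-kl, seat hubbard-kl-k3c3-p3 (g5; implicit-function calculus of the Fermi curve — a TOOL of the `PerturbedFermiCurve` lineage, offered to
the (E3a-F) supplier pair k3c3-p1 (symbol sizes on the scale-`n` tube) / p1b ((M)/(e) assembly), KL STATUS 10:47:38Z).  Under the K3-FLOW ruling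
(plan g16) the engine-flow child's two-leg stub concludes `TwoLegReadJetsF … n`: the CUMULATIVE reading `θ ↦ ν_n(K_n)(θ) = F_n(γ_{K_n}(θ))` has
`|∂_θ^k| ≤ curveJetBar G.S Q.S' U k n` for `k ≤ 4`.  With the symbol sizes the engine proves on the scale-`n` shell — BGM 2006 (2.36)/(3.3):
`‖DˡF_n‖ ≤ μ_l·U²·γ^{(2−l)h}`, here `μ_l·U²·4^{(l−2)n}` — and the flow frame `K_n` of depth `n − 1` (pieces `m < n` only), the GRADED chain rule
(`k!·max_i m_i·D^k`, Mathlib `norm_iteratedFDeriv_comp_le`) loses `Gfr₃U²4ⁿ` at `k = 3` and `Gfr₄U²16ⁿ` at `k = 4` (the curve's own top jets), while the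
STRUCTURED chain rule of this lineage (`abs_iteratedDeriv_comp_fermiPointLp_le_struct`, …PerturbedFermiCurveTower §4: separate `D1, D2, D3(A₃), D4(A₃,A₄)`,
affine in the frame's order-3/4 sizes) fits every `curveJetBar` law with `n`-free constants.  This file does the arithmetic once and for all:

* §1 `frameShift_high_sizes_of_frameOK` — depth-general order-3/4 sizes of an admissible frame: `A₃ ≤ Gfr₃·U²·4^{N+1}/3`, `A₄ ≤ Gfr₄·U²·16^{N+1}/15`
  (`FrameOK R U N μ K`, any `N`; the depth-`nScales β` case is `frame_sizes_of_frameOK_explicit`);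
* §2 the tables **`readJetC μ k`**, **`readJetC' R μ k`** (closed forms in `μ 1 … μ 4`, `klCurveD1/D2/D3 0/D4 0 0`, `klCurveB3/B4/G4`, `R.Gfr 3/4`);
* §3 **`abs_iteratedDeriv_comp_fermiPointLp_le_curveJetBar`** — in the regime (`0 < c ≤ klCurveC3 R`, `0 < U ≤ min 1 (klCurveU0 R)`, `klBetaMin ≤ β ≤ e^{c/U²}`,
  `μ ∈ klWindowC`), for `FrameOK R U N μ K` with `N ≤ n`, `N ≤ nScales β`, and a `C⁴` symbol `F` with `‖DˡF(γ_K θ)‖ ≤ μc l·U²·4^{(l−2)n}` (`1 ≤ l ≤ 4`):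
  `|∂_θ^k (F ∘ γ_K)(θ)| ≤ curveJetBar (readJetC μc) (readJetC' R μc) U k n` for `1 ≤ k ≤ 4` — the shape of `TwoLegReadJetsF`/`TwoLegCurveJetBound` at orders
  `1…4` (order `0` is the value, read directly).

Proofs + two tables; nothing about the model is asserted.  References: BGM 2006 §2.4 (2.36), Lemma 2.1 (2.40), Thm 3.1 (3.2)–(3.3)
[cite: BenfattoGiulianiMastropietro2006].
-/

noncomputable section

namespace Summit.HubbardSuperconductivity.HubbardSuperconductivity.Theorems.KLRegimeSplit

set_option linter.dupNamespace false -- summit = problem name (single-conjunct summit), D-0017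

open Real Finset Literature.MathematicalPhysics.QuantumLattice Literature.Probability.LatticeModels
open Summit.HubbardSuperconductivity.HubbardSuperconductivity.Theorems.DispersionFlow
open Summit.HubbardSuperconductivity.HubbardSuperconductivity.Theorems.PerturbedFermiCurve

/-! ## §1 Depth-general order-3/4 sizes of an admissible frame -/

/-- **Order-3/4 sizes of an admissible frame of depth `N`**: `‖D³(frameShift K)‖ ≤ Gfr₃·U²·4^{N+1}/3` and `‖D⁴(frameShift K)‖ ≤ Gfr₄·U²·16^{N+1}/15`
(per-order geometric sums; any depth `N`). -/
theorem frameShift_high_sizes_of_frameOK {R : RenConsts} (hR : ∀ j, 0 ≤ R.Gfr j) {U : ℝ} {N : ℕ} {μ : ℝ} {K : TrigPolyC4v}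
    (hK : FrameOK R U N μ K) :
    (∀ p : Momentum, ‖iteratedFDeriv ℝ 3 (frameShift K) p‖ ≤ R.Gfr 3 * U ^ 2 * ((4 : ℝ) ^ (N + 1) / 3)) ∧
      ∀ p : Momentum, ‖iteratedFDeriv ℝ 4 (frameShift K) p‖ ≤ R.Gfr 4 * U ^ 2 * ((16 : ℝ) ^ (N + 1) / 15) := by
  constructor
  · intro p
    refine (norm_iteratedFDeriv_frameShift_le_sum_of_frameOK hK p (by norm_num : 3 ≤ 4)).trans ?_
    rw [← mul_sum]
    simp only [uPow, show (3 : ℕ) ≠ 0 from by norm_num, if_false]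
    exact mul_le_mul_of_nonneg_left (sum_four_zpow_order_three_le N) (by have := hR 3; positivity)
  · intro p
    refine (norm_iteratedFDeriv_frameShift_le_sum_of_frameOK hK p le_rfl).trans ?_
    rw [← mul_sum]
    simp only [uPow, show (4 : ℕ) ≠ 0 from by norm_num, if_false]
    exact mul_le_mul_of_nonneg_left (sum_four_zpow_order_four_le N) (by have := hR 4; positivity)

/-! ## §2 The tables -/

/-- **Leading constants of the reading jets** `readJetC μ k` (`k = 1 … 4`; `0` elsewhere):
`μ₁D1 | μ₂D1² + μ₁D2 | μ₃D1³ + 3μ₂D1D2 + μ₁D3(0) | μ₄D1⁴ + 6μ₃D1²D2 + 3μ₂D2² + 4μ₂D1D3(0) + μ₁D4(0,0)`. -/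
def readJetC (μc : ℕ → ℝ) (k : ℕ) : ℝ :=
  if k = 1 then μc 1 * klCurveD1
  else if k = 2 then μc 2 * klCurveD1 ^ 2 + μc 1 * klCurveD2
  else if k = 3 then μc 3 * klCurveD1 ^ 3 + 3 * μc 2 * klCurveD1 * klCurveD2 + μc 1 * klCurveD3 0
  else if k = 4 then
    μc 4 * klCurveD1 ^ 4 + 6 * μc 3 * klCurveD1 ^ 2 * klCurveD2 + 3 * μc 2 * klCurveD2 ^ 2 + 4 * μc 2 * klCurveD1 * klCurveD3 0 +
      μc 1 * klCurveD4 0 0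
  else 0

/-- **`|U|`-slack constants of the reading jets** `readJetC' R μ k` (the frame's own order-3/4 growth, affine coefficients `klCurveB3/B4/G4`):
`k = 3`: `(8/3)·μ₁·B3·Gfr₃`; `k = 4`: `(32/3)·μ₂·D1·B3·Gfr₃ + (4/3)·(8B3 + 2B4)·μ₁·Gfr₃ + (32/15)·μ₁·G4·Gfr₄`; `0` otherwise. -/
def readJetC' (R : RenConsts) (μc : ℕ → ℝ) (k : ℕ) : ℝ :=
  if k = 3 then 8 / 3 * μc 1 * klCurveB3 * R.Gfr 3
  else if k = 4 then
    32 / 3 * μc 2 * klCurveD1 * klCurveB3 * R.Gfr 3 + 4 / 3 * (8 * klCurveB3 + 2 * klCurveB4) * μc 1 * R.Gfr 3 +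
      32 / 15 * μc 1 * klCurveG4 * R.Gfr 4
  else 0

/-- `readJetC` at order 1. -/
theorem readJetC_one (μc : ℕ → ℝ) : readJetC μc 1 = μc 1 * klCurveD1 := by simp [readJetC]
/-- `readJetC` at order 2. -/
theorem readJetC_two (μc : ℕ → ℝ) : readJetC μc 2 = μc 2 * klCurveD1 ^ 2 + μc 1 * klCurveD2 := by simp [readJetC]
/-- `readJetC` at order 3. -/
theorem readJetC_three (μc : ℕ → ℝ) :
    readJetC μc 3 = μc 3 * klCurveD1 ^ 3 + 3 * μc 2 * klCurveD1 * klCurveD2 + μc 1 * klCurveD3 0 := by simp [readJetC]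
/-- `readJetC` at order 4. -/
theorem readJetC_four (μc : ℕ → ℝ) :
    readJetC μc 4 = μc 4 * klCurveD1 ^ 4 + 6 * μc 3 * klCurveD1 ^ 2 * klCurveD2 + 3 * μc 2 * klCurveD2 ^ 2 +
      4 * μc 2 * klCurveD1 * klCurveD3 0 + μc 1 * klCurveD4 0 0 := by simp [readJetC]
/-- `readJetC'` at order 1. -/
theorem readJetC'_one (R : RenConsts) (μc : ℕ → ℝ) : readJetC' R μc 1 = 0 := by simp [readJetC']
/-- `readJetC'` at order 2. -/
theorem readJetC'_two (R : RenConsts) (μc : ℕ → ℝ) : readJetC' R μc 2 = 0 := by simp [readJetC']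
/-- `readJetC'` at order 3. -/
theorem readJetC'_three (R : RenConsts) (μc : ℕ → ℝ) : readJetC' R μc 3 = 8 / 3 * μc 1 * klCurveB3 * R.Gfr 3 := by simp [readJetC']
/-- `readJetC'` at order 4. -/
theorem readJetC'_four (R : RenConsts) (μc : ℕ → ℝ) :
    readJetC' R μc 4 = 32 / 3 * μc 2 * klCurveD1 * klCurveB3 * R.Gfr 3 + 4 / 3 * (8 * klCurveB3 + 2 * klCurveB4) * μc 1 * R.Gfr 3 +
      32 / 15 * μc 1 * klCurveG4 * R.Gfr 4 := by simp [readJetC']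

/-! ## §3 The arithmetic of the four orders (abstract nonnegative reals; `U ≤ 1`, `x = 4ⁿ ≥ 1`) -/

section Arith

variable {b μ₁ μ₂ μ₃ μ₄ D1 D2 D30 D40 B3 B4 G4 g3 g4 D3A D4A U x : ℝ}

/-- Order 2: `μ₂U²D1² + μ₁U²x⁻¹D2 ≤ (μ₂D1² + μ₁D2)·U²`. -/
theorem readJet_arith_two (hb : b ≤ μ₂ * U ^ 2 * D1 ^ 2 + μ₁ * U ^ 2 * x⁻¹ * D2) (hμ₁ : 0 ≤ μ₁) (hD2 : 0 ≤ D2) (hx : 1 ≤ x) :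
    b ≤ (μ₂ * D1 ^ 2 + μ₁ * D2 + 0 * U) * U ^ 2 * 1 := by
  have hxi : x⁻¹ ≤ 1 := inv_le_one_of_one_le₀ hx
  have h0 : 0 ≤ μ₁ * U ^ 2 * D2 := by positivity
  have h1 : μ₁ * U ^ 2 * x⁻¹ * D2 ≤ μ₁ * U ^ 2 * D2 := by nlinarith [mul_le_mul_of_nonneg_left hxi h0]
  nlinarith

set_option maxHeartbeats 400000 in -- order-3/4 polynomial arithmetic: budget line in v1 (ops standing ask 2026-08-27)
/-- Order 3: with `D3A ≤ D30 + 2·B3·(g3·U²·(4/3·x))`,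
`μ₃U²xD1³ + 3μ₂U²D1D2 + μ₁U²x⁻¹D3A ≤ (μ₃D1³ + 3μ₂D1D2 + μ₁D30 + (8/3·μ₁B3g3)·U)·U²·x`. -/
theorem readJet_arith_three (hb : b ≤ μ₃ * U ^ 2 * x * D1 ^ 3 + 3 * (μ₂ * U ^ 2) * D1 * D2 + μ₁ * U ^ 2 * x⁻¹ * D3A)
    (hD3 : D3A ≤ D30 + 2 * B3 * (g3 * U ^ 2 * (4 / 3 * x))) (hμ₁ : 0 ≤ μ₁) (hμ₂ : 0 ≤ μ₂) (hD1 : 0 ≤ D1) (hD2 : 0 ≤ D2)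
    (hD30 : 0 ≤ D30) (hB3 : 0 ≤ B3) (hg3 : 0 ≤ g3) (hU0 : 0 ≤ U) (hU1 : U ≤ 1) (hx : 1 ≤ x) :
    b ≤ (μ₃ * D1 ^ 3 + 3 * μ₂ * D1 * D2 + μ₁ * D30 + 8 / 3 * μ₁ * B3 * g3 * U) * U ^ 2 * x := by
  have hx0 : 0 < x := by linarith
  have hxi : x⁻¹ ≤ 1 := inv_le_one_of_one_le₀ hx
  have hxi0 : 0 ≤ x⁻¹ := by positivity
  have hU2 : 0 ≤ U ^ 2 := by positivity
  have hU21 : U ^ 2 ≤ U := by nlinarith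
  -- the D3 term
  have s1 : μ₁ * U ^ 2 * x⁻¹ * D3A ≤ μ₁ * U ^ 2 * x⁻¹ * (D30 + 2 * B3 * (g3 * U ^ 2 * (4 / 3 * x))) :=
    mul_le_mul_of_nonneg_left hD3 (by positivity)
  have e1 : μ₁ * U ^ 2 * x⁻¹ * (D30 + 2 * B3 * (g3 * U ^ 2 * (4 / 3 * x))) =
      μ₁ * D30 * U ^ 2 * x⁻¹ + 8 / 3 * μ₁ * B3 * g3 * U ^ 2 * U ^ 2 * (x⁻¹ * x) := by ring
  rw [inv_mul_cancel₀ (ne_of_gt hx0), mul_one] at e1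
  have h0 : 0 ≤ μ₁ * D30 * U ^ 2 := by positivity
  have s2 : μ₁ * D30 * U ^ 2 * x⁻¹ ≤ μ₁ * D30 * U ^ 2 * x := by
    nlinarith [mul_le_mul_of_nonneg_left hxi h0, mul_le_mul_of_nonneg_left hx h0]
  have h1 : 0 ≤ 8 / 3 * μ₁ * B3 * g3 * U ^ 2 := by positivity
  have s3 : 8 / 3 * μ₁ * B3 * g3 * U ^ 2 * U ^ 2 ≤ 8 / 3 * μ₁ * B3 * g3 * U * U ^ 2 * x := by
    have := mul_le_mul_of_nonneg_left hU21 h1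
    have := mul_le_mul_of_nonneg_left hx (mul_nonneg h1 hU0)
    nlinarith
  -- the middle term
  have h2 : 0 ≤ 3 * μ₂ * D1 * D2 * U ^ 2 := by positivity
  have s4 : 3 * (μ₂ * U ^ 2) * D1 * D2 ≤ 3 * μ₂ * D1 * D2 * U ^ 2 * x := by nlinarith [mul_le_mul_of_nonneg_left hx h2]
  nlinarith [s1, s2, s3, s4, e1]

/-- The monomial comparison used at orders 3 and 4: `U²·x ≤ U·x²` for `0 ≤ U ≤ 1 ≤ x`. -/
theorem sq_mul_le_mul_sq {U x : ℝ} (hU0 : 0 ≤ U) (hU1 : U ≤ 1) (hx : 1 ≤ x) : U ^ 2 * x ≤ U * x ^ 2 := by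
  have hU21 : U ^ 2 ≤ U := by nlinarith
  have hxx2 : x ≤ x ^ 2 := by nlinarith
  have hx0 : 0 ≤ x := by linarith
  calc U ^ 2 * x ≤ U * x := mul_le_mul_of_nonneg_right hU21 hx0
    _ ≤ U * x ^ 2 := mul_le_mul_of_nonneg_left hxx2 hU0

set_option maxHeartbeats 400000 in -- order-3/4 polynomial arithmetic: budget line in v1 (ops standing ask 2026-08-27)
/-- Order 4, the `D3` term: `4μ₂U²D1·D3A ≤ (4μ₂D1D30)·U²x² + (32/3·μ₂D1B3g3)·U·U²x²`. -/
theorem readJet_arith_four_t4 (hD3 : D3A ≤ D30 + 2 * B3 * (g3 * U ^ 2 * (4 / 3 * x))) (hμ₂ : 0 ≤ μ₂) (hD1 : 0 ≤ D1) (hD30 : 0 ≤ D30)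
    (hB3 : 0 ≤ B3) (hg3 : 0 ≤ g3) (hU0 : 0 ≤ U) (hU1 : U ≤ 1) (hx : 1 ≤ x) :
    4 * (μ₂ * U ^ 2) * D1 * D3A ≤ 4 * μ₂ * D1 * D30 * U ^ 2 * x ^ 2 + 32 / 3 * μ₂ * D1 * B3 * g3 * U * U ^ 2 * x ^ 2 := by
  have hx2 : 1 ≤ x ^ 2 := one_le_pow₀ hx
  have s4 : 4 * (μ₂ * U ^ 2) * D1 * D3A ≤ 4 * (μ₂ * U ^ 2) * D1 * (D30 + 2 * B3 * (g3 * U ^ 2 * (4 / 3 * x))) :=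
    mul_le_mul_of_nonneg_left hD3 (by positivity)
  have e4 : 4 * (μ₂ * U ^ 2) * D1 * (D30 + 2 * B3 * (g3 * U ^ 2 * (4 / 3 * x))) =
      4 * μ₂ * D1 * D30 * U ^ 2 + 32 / 3 * μ₂ * D1 * B3 * g3 * U ^ 2 * (U ^ 2 * x) := by ring
  have h4a : 0 ≤ 4 * μ₂ * D1 * D30 * U ^ 2 := by positivity
  have t4a : 4 * μ₂ * D1 * D30 * U ^ 2 ≤ 4 * μ₂ * D1 * D30 * U ^ 2 * x ^ 2 := by
    have := mul_le_mul_of_nonneg_left hx2 h4a; linarith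
  have h4b : 0 ≤ 32 / 3 * μ₂ * D1 * B3 * g3 * U ^ 2 := by positivity
  have t4b : 32 / 3 * μ₂ * D1 * B3 * g3 * U ^ 2 * (U ^ 2 * x) ≤ 32 / 3 * μ₂ * D1 * B3 * g3 * U ^ 2 * (U * x ^ 2) :=
    mul_le_mul_of_nonneg_left (sq_mul_le_mul_sq hU0 hU1 hx) h4b
  have e4b : 32 / 3 * μ₂ * D1 * B3 * g3 * U ^ 2 * (U * x ^ 2) = 32 / 3 * μ₂ * D1 * B3 * g3 * U * U ^ 2 * x ^ 2 := by ring
  linarith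

set_option maxHeartbeats 400000 in -- order-3/4 polynomial arithmetic: budget line in v1 (ops standing ask 2026-08-27)
/-- Order 4, the `D4` term: `μ₁U²x⁻¹·D4A ≤ (μ₁D40)·U²x² + (4/3(8B3+2B4)μ₁g3 + 32/15·μ₁G4g4)·U·U²x²`. -/
theorem readJet_arith_four_t5
    (hD4 : D4A ≤ D40 + (8 * B3 + 2 * B4) * (g3 * U ^ 2 * (4 / 3 * x)) + 2 * G4 * (g4 * U ^ 2 * (16 / 15 * x ^ 2)))
    (hμ₁ : 0 ≤ μ₁) (hD40 : 0 ≤ D40) (hB3 : 0 ≤ B3) (hB4 : 0 ≤ B4) (hG4 : 0 ≤ G4) (hg3 : 0 ≤ g3) (hg4 : 0 ≤ g4) (hU0 : 0 ≤ U)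
    (hU1 : U ≤ 1) (hx : 1 ≤ x) :
    μ₁ * U ^ 2 * x⁻¹ * D4A ≤
      μ₁ * D40 * U ^ 2 * x ^ 2 + (4 / 3 * (8 * B3 + 2 * B4) * μ₁ * g3 + 32 / 15 * μ₁ * G4 * g4) * U * U ^ 2 * x ^ 2 := by
  have hx0 : 0 < x := by linarith
  have hxi : x⁻¹ ≤ 1 := inv_le_one_of_one_le₀ hx
  have hxi0 : 0 ≤ x⁻¹ := by positivity
  have hx2 : 1 ≤ x ^ 2 := one_le_pow₀ hx
  have hU21 : U ^ 2 ≤ U := by nlinarith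
  have s5 : μ₁ * U ^ 2 * x⁻¹ * D4A ≤ μ₁ * U ^ 2 * x⁻¹ *
      (D40 + (8 * B3 + 2 * B4) * (g3 * U ^ 2 * (4 / 3 * x)) + 2 * G4 * (g4 * U ^ 2 * (16 / 15 * x ^ 2))) :=
    mul_le_mul_of_nonneg_left hD4 (by positivity)
  have e5 : μ₁ * U ^ 2 * x⁻¹ * (D40 + (8 * B3 + 2 * B4) * (g3 * U ^ 2 * (4 / 3 * x)) + 2 * G4 * (g4 * U ^ 2 * (16 / 15 * x ^ 2))) =
      μ₁ * D40 * U ^ 2 * x⁻¹ + 4 / 3 * (8 * B3 + 2 * B4) * μ₁ * g3 * U ^ 2 * U ^ 2 * (x⁻¹ * x) +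
        32 / 15 * μ₁ * G4 * g4 * U ^ 2 * (U ^ 2 * x) * (x⁻¹ * x) := by ring
  rw [inv_mul_cancel₀ (ne_of_gt hx0), mul_one, mul_one] at e5
  have h5a : 0 ≤ μ₁ * D40 * U ^ 2 := by positivity
  have t5a : μ₁ * D40 * U ^ 2 * x⁻¹ ≤ μ₁ * D40 * U ^ 2 * x ^ 2 := by
    have a1 := mul_le_mul_of_nonneg_left hxi h5a
    have a2 := mul_le_mul_of_nonneg_left hx2 h5a
    linarith
  have h5b : 0 ≤ 4 / 3 * (8 * B3 + 2 * B4) * μ₁ * g3 * U ^ 2 := by positivity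
  have t5b : 4 / 3 * (8 * B3 + 2 * B4) * μ₁ * g3 * U ^ 2 * U ^ 2 ≤ 4 / 3 * (8 * B3 + 2 * B4) * μ₁ * g3 * U ^ 2 * (U * x ^ 2) := by
    refine mul_le_mul_of_nonneg_left ?_ h5b
    calc U ^ 2 ≤ U := hU21
      _ = U * 1 := (mul_one U).symm
      _ ≤ U * x ^ 2 := mul_le_mul_of_nonneg_left hx2 hU0
  have h5c : 0 ≤ 32 / 15 * μ₁ * G4 * g4 * U ^ 2 := by positivity
  have t5c : 32 / 15 * μ₁ * G4 * g4 * U ^ 2 * (U ^ 2 * x) ≤ 32 / 15 * μ₁ * G4 * g4 * U ^ 2 * (U * x ^ 2) :=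
    mul_le_mul_of_nonneg_left (sq_mul_le_mul_sq hU0 hU1 hx) h5c
  have efin : μ₁ * D40 * U ^ 2 * x ^ 2 + (4 / 3 * (8 * B3 + 2 * B4) * μ₁ * g3 + 32 / 15 * μ₁ * G4 * g4) * U * U ^ 2 * x ^ 2 =
      μ₁ * D40 * U ^ 2 * x ^ 2 + 4 / 3 * (8 * B3 + 2 * B4) * μ₁ * g3 * U ^ 2 * (U * x ^ 2) +
        32 / 15 * μ₁ * G4 * g4 * U ^ 2 * (U * x ^ 2) := by ring
  linarith

set_option maxHeartbeats 400000 in -- order-3/4 polynomial arithmetic: budget line in v1 (ops standing ask 2026-08-27)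
/-- Order 4: the Bell bound is within `(readJetC 4 + readJetC' 4·U)·U²·x²`. -/
theorem readJet_arith_four
    (hb : b ≤ μ₄ * U ^ 2 * x ^ 2 * D1 ^ 4 + 6 * (μ₃ * U ^ 2 * x) * D1 ^ 2 * D2 + 3 * (μ₂ * U ^ 2) * D2 ^ 2 +
      4 * (μ₂ * U ^ 2) * D1 * D3A + μ₁ * U ^ 2 * x⁻¹ * D4A)
    (hD3 : D3A ≤ D30 + 2 * B3 * (g3 * U ^ 2 * (4 / 3 * x)))
    (hD4 : D4A ≤ D40 + (8 * B3 + 2 * B4) * (g3 * U ^ 2 * (4 / 3 * x)) + 2 * G4 * (g4 * U ^ 2 * (16 / 15 * x ^ 2)))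
    (hμ₁ : 0 ≤ μ₁) (hμ₂ : 0 ≤ μ₂) (hμ₃ : 0 ≤ μ₃) (hD1 : 0 ≤ D1) (hD2 : 0 ≤ D2) (hD30 : 0 ≤ D30) (hD40 : 0 ≤ D40) (hB3 : 0 ≤ B3)
    (hB4 : 0 ≤ B4) (hG4 : 0 ≤ G4) (hg3 : 0 ≤ g3) (hg4 : 0 ≤ g4) (hU0 : 0 ≤ U) (hU1 : U ≤ 1) (hx : 1 ≤ x) :
    b ≤ (μ₄ * D1 ^ 4 + 6 * μ₃ * D1 ^ 2 * D2 + 3 * μ₂ * D2 ^ 2 + 4 * μ₂ * D1 * D30 + μ₁ * D40 +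
        (32 / 3 * μ₂ * D1 * B3 * g3 + 4 / 3 * (8 * B3 + 2 * B4) * μ₁ * g3 + 32 / 15 * μ₁ * G4 * g4) * U) * U ^ 2 * x ^ 2 := by
  have hx2 : 1 ≤ x ^ 2 := one_le_pow₀ hx
  have hxx2 : x ≤ x ^ 2 := by nlinarith
  have h2 : 0 ≤ 6 * μ₃ * D1 ^ 2 * D2 * U ^ 2 := by positivity
  have t2 : 6 * (μ₃ * U ^ 2 * x) * D1 ^ 2 * D2 ≤ 6 * μ₃ * D1 ^ 2 * D2 * U ^ 2 * x ^ 2 := by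
    have a := mul_le_mul_of_nonneg_left hxx2 h2; linarith
  have h3 : 0 ≤ 3 * μ₂ * D2 ^ 2 * U ^ 2 := by positivity
  have t3 : 3 * (μ₂ * U ^ 2) * D2 ^ 2 ≤ 3 * μ₂ * D2 ^ 2 * U ^ 2 * x ^ 2 := by
    have a := mul_le_mul_of_nonneg_left hx2 h3; linarith
  have t4 := readJet_arith_four_t4 hD3 hμ₂ hD1 hD30 hB3 hg3 hU0 hU1 hx
  have t5 := readJet_arith_four_t5 hD4 hμ₁ hD40 hB3 hB4 hG4 hg3 hg4 hU0 hU1 hx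
  have efin : (μ₄ * D1 ^ 4 + 6 * μ₃ * D1 ^ 2 * D2 + 3 * μ₂ * D2 ^ 2 + 4 * μ₂ * D1 * D30 + μ₁ * D40 +
        (32 / 3 * μ₂ * D1 * B3 * g3 + 4 / 3 * (8 * B3 + 2 * B4) * μ₁ * g3 + 32 / 15 * μ₁ * G4 * g4) * U) * U ^ 2 * x ^ 2 =
      μ₄ * U ^ 2 * x ^ 2 * D1 ^ 4 + 6 * μ₃ * D1 ^ 2 * D2 * U ^ 2 * x ^ 2 + 3 * μ₂ * D2 ^ 2 * U ^ 2 * x ^ 2 +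
        (4 * μ₂ * D1 * D30 * U ^ 2 * x ^ 2 + 32 / 3 * μ₂ * D1 * B3 * g3 * U * U ^ 2 * x ^ 2) +
        (μ₁ * D40 * U ^ 2 * x ^ 2 + (4 / 3 * (8 * B3 + 2 * B4) * μ₁ * g3 + 32 / 15 * μ₁ * G4 * g4) * U * U ^ 2 * x ^ 2) := by
    ring
  linarith

end Arith

/-! ## §4 The structured link -/

section Link

variable {R : RenConsts} {c U β μ : ℝ} {K : TrigPolyC4v} {N n : ℕ} {F : Momentum → ℝ} {μc : ℕ → ℝ}

/-- Powers of `4` at order `1`. -/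
private theorem four_zpow_ord_one (n : ℕ) : (4 : ℝ) ^ ((((1 : ℕ) : ℤ) - 2) * n) = ((4 : ℝ) ^ n)⁻¹ := by
  rw [show (((1 : ℕ) : ℤ) - 2) * n = -(n : ℤ) by push_cast; ring, zpow_neg, zpow_natCast]

/-- Powers of `4` at order `2`. -/
private theorem four_zpow_ord_two (n : ℕ) : (4 : ℝ) ^ ((((2 : ℕ) : ℤ) - 2) * n) = 1 := by
  rw [show (((2 : ℕ) : ℤ) - 2) * n = (0 : ℤ) by push_cast; ring, zpow_zero]

/-- Powers of `4` at order `3`. -/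
private theorem four_zpow_ord_three (n : ℕ) : (4 : ℝ) ^ ((((3 : ℕ) : ℤ) - 2) * n) = (4 : ℝ) ^ n := by
  rw [show (((3 : ℕ) : ℤ) - 2) * n = (n : ℤ) by push_cast; ring, zpow_natCast]

/-- Powers of `4` at order `4`. -/
private theorem four_zpow_ord_four (n : ℕ) : (4 : ℝ) ^ ((((4 : ℕ) : ℤ) - 2) * n) = ((4 : ℝ) ^ n) ^ 2 := by
  rw [show (((4 : ℕ) : ℤ) - 2) * n = ((2 * n : ℕ) : ℤ) by push_cast; ring, zpow_natCast, pow_mul']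

set_option maxHeartbeats 400000 in -- order-3/4 polynomial arithmetic: budget line in v1 (ops standing ask 2026-08-27)
/-- **THE STRUCTURED (E3a-F) LINK.**  In the regime, for an admissible frame of depth `N ≤ n` (`N ≤ nScales β`) and a `C⁴` symbol `F` whose
derivatives AT THE CURVE POINTS obey the BGM shape `‖DˡF(γ_K θ)‖ ≤ μc l·U²·4^{(l−2)n}` (`1 ≤ l ≤ 4`, `μc ≥ 0`):
`|∂_θ^k (F ∘ γ_K)(θ)| ≤ curveJetBar (readJetC μc) (readJetC' R μc) U k n` for `1 ≤ k ≤ 4`. -/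
theorem abs_iteratedDeriv_comp_fermiPointLp_le_curveJetBar (hR : ∀ j, 0 ≤ R.Gfr j) (hc : 0 < c) (hcle : c ≤ klCurveC3 R)
    (hU : 0 < U) (hUle : U ≤ klCurveU0 R) (hU1 : U ≤ 1) (hβmin : klBetaMin ≤ β) (hβc : β ≤ Real.exp (c / U ^ 2)) (hμ : μ ∈ klWindowC)
    (hK : FrameOK R U N μ K) (hNn : N ≤ n) (hNβ : N ≤ nScales β) (hF : ContDiff ℝ 4 F) (hμc : ∀ l, 0 ≤ μc l) (θ : ℝ)
    (hm : ∀ l, 1 ≤ l → l ≤ 4 →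
      ‖iteratedFDeriv ℝ l F (WithLp.toLp 2 (klFermiPoint μ K θ))‖ ≤ μc l * U ^ 2 * (4 : ℝ) ^ (((l : ℤ) - 2) * n))
    {k : ℕ} (hk1 : 1 ≤ k) (hk : k ≤ 4) :
    |iteratedDeriv k (F ∘ fun θ : ℝ => (WithLp.toLp 2 (klFermiPoint μ K θ) : Momentum)) θ| ≤
      curveJetBar (readJetC μc) (readJetC' R μc) U k n := by
  -- the frame at depth `nScales β` and its order-3/4 sizes at the TRUE depth `N ≤ n`
  have hK' : FrameOK R U (nScales β) μ K := FrameOK.mono hR hNβ hK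
  obtain ⟨hA₃, hA₄⟩ := frameShift_high_sizes_of_frameOK hR hK
  set A₃ : ℝ := R.Gfr 3 * U ^ 2 * ((4 : ℝ) ^ (N + 1) / 3) with hA₃def
  set A₄ : ℝ := R.Gfr 4 * U ^ 2 * ((16 : ℝ) ^ (N + 1) / 15) with hA₄def
  set x : ℝ := (4 : ℝ) ^ n with hx
  have hx1 : 1 ≤ x := one_le_pow₀ (by norm_num)
  have habs : |U| = U := abs_of_pos hU
  have hG3 := hR 3; have hGf4 := hR 4
  -- `A₃ ≤ Gfr₃U²·(4/3)·x`, `A₄ ≤ Gfr₄U²·(16/15)·x²`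
  have h4N : (4 : ℝ) ^ (N + 1) ≤ 4 * x := by
    rw [pow_succ, hx]; have := pow_le_pow_right₀ (by norm_num : (1 : ℝ) ≤ 4) hNn; linarith
  have h16N : (16 : ℝ) ^ (N + 1) ≤ 16 * x ^ 2 := by
    rw [pow_succ, hx, ← pow_mul, show (16 : ℝ) = 4 ^ 2 by norm_num, ← pow_mul]
    have := pow_le_pow_right₀ (by norm_num : (1 : ℝ) ≤ 4) (show 2 * N ≤ n * 2 by omega); nlinarith
  have hA₃0 : 0 ≤ A₃ := by positivity
  have hA₄0 : 0 ≤ A₄ := by positivity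
  have hA₃x : A₃ ≤ R.Gfr 3 * U ^ 2 * (4 / 3 * x) := by
    rw [hA₃def]; exact mul_le_mul_of_nonneg_left (by linarith) (by positivity)
  have hA₄x : A₄ ≤ R.Gfr 4 * U ^ 2 * (16 / 15 * x ^ 2) := by
    rw [hA₄def]; exact mul_le_mul_of_nonneg_left (by linarith) (by positivity)
  -- the symbol sizes at the four orders, in `x`
  set m : ℕ → ℝ := fun l => if l = 1 then μc 1 * U ^ 2 * x⁻¹ else if l = 2 then μc 2 * U ^ 2 else if l = 3 then μc 3 * U ^ 2 * x
    else μc 4 * U ^ 2 * x ^ 2 with hmdef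
  have hmall : ∀ l, 1 ≤ l → l ≤ 4 → ‖iteratedFDeriv ℝ l F (WithLp.toLp 2 (klFermiPoint μ K θ))‖ ≤ m l := by
    intro l hl1 hl4
    have h := hm l hl1 hl4
    interval_cases l
    · rw [four_zpow_ord_one] at h; simpa [hmdef] using h
    · rw [four_zpow_ord_two, mul_one] at h; simpa [hmdef] using h
    · rw [four_zpow_ord_three] at h; simpa [hmdef] using h
    · rw [four_zpow_ord_four] at h; simpa [hmdef] using h
  obtain ⟨b1, b2, b3, b4⟩ :=
    abs_iteratedDeriv_comp_fermiPointLp_le_struct hR hc hcle hU hUle hβmin hβc hμ hK' hA₃ hA₄ hF θ hmall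
  simp only [hmdef, if_true, show (2 : ℕ) ≠ 1 from by norm_num, show (3 : ℕ) ≠ 1 from by norm_num, show (3 : ℕ) ≠ 2 from by norm_num,
    show (4 : ℕ) ≠ 1 from by norm_num, show (4 : ℕ) ≠ 2 from by norm_num, show (4 : ℕ) ≠ 3 from by norm_num, if_false] at b1 b2 b3 b4
  -- nonnegativity of the curve constants and the affine forms
  obtain ⟨hD1, hD2, hD30, hD400⟩ := klCurveD_sizes_nonneg (A₃ := 0) (A₄ := 0) le_rfl le_rfl
  have hB3 := klCurveB3_nonneg; have hB4 := klCurveB4_nonneg; have hG4 := klCurveG4_nonneg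
  have hD3 : klCurveD3 A₃ ≤ klCurveD3 0 + 2 * klCurveB3 * (R.Gfr 3 * U ^ 2 * (4 / 3 * x)) := by
    rw [klCurveD3_affine A₃, klCurveD3_affine 0]
    have := mul_le_mul_of_nonneg_left hA₃x (show 0 ≤ 2 * klCurveB3 by positivity)
    linarith
  have hD4 : klCurveD4 A₃ A₄ ≤ klCurveD4 0 0 + (8 * klCurveB3 + 2 * klCurveB4) * (R.Gfr 3 * U ^ 2 * (4 / 3 * x)) +
      2 * klCurveG4 * (R.Gfr 4 * U ^ 2 * (16 / 15 * x ^ 2)) := by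
    rw [klCurveD4_affine A₃ A₄, klCurveD4_affine 0 0]
    have h1 := mul_le_mul_of_nonneg_left hA₃x (show 0 ≤ 8 * klCurveB3 + 2 * klCurveB4 by positivity)
    have h2 := mul_le_mul_of_nonneg_left hA₄x (show 0 ≤ 2 * klCurveG4 by positivity)
    linarith
  -- the four orders
  rw [curveJetBar_apply, habs]
  rcases Nat.lt_or_ge k 3 with hk3 | hk3
  · rcases Nat.lt_or_ge k 2 with hk2 | hk2
    · obtain rfl : k = 1 := by omega
      rw [four_zpow_ord_one, uPow_of_ne_zero one_ne_zero, readJetC_one, readJetC'_one]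
      refine b1.trans (le_of_eq ?_); ring
    · obtain rfl : k = 2 := by omega
      rw [four_zpow_ord_two, uPow_of_ne_zero (by norm_num), readJetC_two, readJetC'_two]
      exact readJet_arith_two b2 (hμc 1) hD2 hx1
  · rcases Nat.lt_or_ge k 4 with hk4 | hk4
    · obtain rfl : k = 3 := by omega
      rw [four_zpow_ord_three, uPow_of_ne_zero (by norm_num), readJetC_three, readJetC'_three]
      exact readJet_arith_three b3 hD3 (hμc 1) (hμc 2) hD1 hD2 hD30 hB3 hG3 hU.le hU1 hx1
    · obtain rfl : k = 4 := by omega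
      rw [four_zpow_ord_four, uPow_of_ne_zero (by norm_num), readJetC_four, readJetC'_four]
      exact readJet_arith_four b4 hD3 hD4 (hμc 1) (hμc 2) (hμc 3) hD1 hD2 hD30 hD400 hB3 hB4 hG4 hG3 hGf4 hU.le hU1 hx1

end Link

end Summit.HubbardSuperconductivity.HubbardSuperconductivity.Theorems.KLRegimeSplit

end
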